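import Mathlib.LinearAlgebra.Eigenspace.Zero
import Mathlib.LinearAlgebra.Eigenspace.Semisimple
import Mathlib.LinearAlgebra.Semisimple
import Mathlib.RingTheory.TensorProduct.Maps
import Mathlib.RingTheory.TensorProduct.Finite
import Literature.NumberTheory.Automorphic.LocalConstants
import Literature.NumberTheory.GaloisRepresentations.WeilDeligneRepProofs
import Literature.NumberTheory.GaloisRepresentations.LocalGaloisGroupProofs
import Literature.NumberTheory.EllipticCurves.FunctionFieldEllipticLFormalOrderProofs
import HarnessLib

/-!
# Route IrreducibilityBySelfDuality — `ReciprocityUpToIrreducibilityR` (stmt-Langlands-17925), line `Sketch`: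
# stub S-17a-A `stub_rootMultiplicity_eulerFactor_tprod_eq_finrank` (`--supports` file; no definitions)

**The order of the pole of `L(s, σ ⊗ τ)` at `s = 0` is the dimension of the Weil–Deligne
invariants.**  For a Frobenius-semisimple Weil–Deligne representation `r = (ρ, N)` of `W_F` on a
finite-dimensional space `X` (over any field `C` of characteristic `0`), the multiplicity of the
root `T = 1` of the Euler factor `det(1 - T·Φ | (ker N)^{I_F})` equals
`dim_C (ker N ⊓ X^{W_F})`; applied to `r = σ ⊗ τ` (`WeilDeligneRep.tprod`), which is
Frobenius-semisimple when `σ` and `τ` are.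

Proof (linear algebra; every ingredient is proved in the tree or in Mathlib):

* `isSemisimple_tensorProduct_map`: `f ⊗ g = (f ⊗ 1) ∘ (1 ⊗ g)` is a product of two commuting
  semisimple endomorphisms (`f ⊗ 1` is killed by the square-free minimal polynomial of `f`,
  `Module.End.rTensorAlgHom` being an algebra map; Mathlib
  `Module.End.isSemisimple_of_squarefree_aeval_eq_zero`, `Module.End.IsSemisimple.mul_of_commute`
  over a perfect field), whence `isFrobSemisimple_tprod`.
* `rootMultiplicity_eulerFactor_eq_finrank_of_isFrobSemisimple`: the Euler factor is the reverse of
  the characteristic polynomial of `M = ρ(Φ)|_{(ker N)^{I_F}}`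
  (`WeilDeligneRep.eulerFactor_eq_reverse_charpoly`), and reversing does not change the multiplicity
  of the root `1` (`Literature.NumberTheory.EllipticCurves.FunctionField.rootMultiplicity_inv_reverse`);
  `M` is semisimple as the restriction of the semisimple `ρ(Φ)` (`Module.End.IsSemisimple.restrict`),
  so the algebraic multiplicity of the eigenvalue `1` (`LinearMap.finrank_maxGenEigenspace_eq`) is
  the geometric one (`Module.End.IsFinitelySemisimple.maxGenEigenspace_eq_eigenspace`); finally the
  `Φ`-fixed vectors of `(ker N)^{I_F}` are exactly `ker N ⊓ X^{W_F}` because `W_F = ⋃_k I_F Φ^k`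
  (`forall_apply_eq_of_forall_mem_inertia_of_deg_eq_neg_one`, from the discharged facts
  `IsFrobPow.mul_holds` / `IsFrobPow.unique_holds` via `WeilGroup.degHom` and
  `WeilGroup.mul_inv_mem_inertia_of_deg_eq`).

Sources: J. Tate, *Number theoretic background* (Corvallis 1979), (4.1.6) (the local factor
`L(V, s) = det(1 - Φ q^{-s} | V_N^I)^{-1}`); G. Henniart, *Une caractérisation de la correspondance
de Langlands locale pour `GL(n)`*, Bull. Soc. Math. France 130 (2002), §1.7 (the pole order of
`L(s, σ ⊗ τ)` at `s = 0` as `dim Hom_{WD}(τ^∨, σ)`).  Standard axioms only; no `sorry`.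
-/

noncomputable section

set_option linter.dupNamespace false

open scoped TensorProduct
open Module Polynomial
open Literature.NumberTheory.Automorphic Literature.NumberTheory.GaloisRepresentations
open Literature.NumberTheory.GaloisRepresentations.WeilGroup
open Literature.NumberTheory.GaloisRepresentations.IsNonarchimedeanLocalField

namespace Summit.Langlands.Langlands.Theorems.ReciprocityUpToIrreducibilityR

/-! ## Semisimple endomorphisms and tensor products -/

/-- **Algebra maps out of `End_K(M)` preserve semisimplicity** (finite-dimensional `M`): the image
`φ f` of a semisimple `f` is killed by the square-free minimal polynomial of `f`
(`aeval (φ f) p = φ (aeval f p)`), hence is semisimple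
(`Module.End.isSemisimple_of_squarefree_aeval_eq_zero`). [folklore] -/
theorem isSemisimple_map_algHom {K : Type*} [Field K] {M : Type*} [AddCommGroup M] [Module K M]
    [FiniteDimensional K M] {M' : Type*} [AddCommGroup M'] [Module K M']
    {A : Type*} [FunLike A (Module.End K M) (Module.End K M')]
    [AlgHomClass A K (Module.End K M) (Module.End K M')] (φ : A) {f : Module.End K M}
    (hf : f.IsSemisimple) : Module.End.IsSemisimple (φ f) :=
  Module.End.isSemisimple_of_squarefree_aeval_eq_zero hf.minpoly_squarefree
    (by rw [aeval_algHom_apply, minpoly.aeval, map_zero])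

/-- **The tensor product of two semisimple endomorphisms is semisimple** (finite-dimensional
spaces over a perfect field): `f ⊗ g = (f ⊗ 1) ∘ (1 ⊗ g)` with commuting factors, `f ⊗ 1` and
`1 ⊗ g` are semisimple as images of `f`, `g` under the algebra maps `Module.End.rTensorAlgHom`,
`Module.End.lTensorAlgHom`, and a product of commuting semisimple endomorphisms is semisimple
(`Module.End.IsSemisimple.mul_of_commute`).  Ref: Bourbaki, *Algèbre*, Ch. VIII (2012), §9,
no. 2–4. [folklore] -/
theorem isSemisimple_tensorProduct_map {K : Type*} [Field K] [PerfectField K]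
    {M : Type*} [AddCommGroup M] [Module K M] [FiniteDimensional K M]
    {M' : Type*} [AddCommGroup M'] [Module K M'] [FiniteDimensional K M']
    {f : Module.End K M} {g : Module.End K M'} (hf : f.IsSemisimple) (hg : g.IsSemisimple) :
    Module.End.IsSemisimple (TensorProduct.map f g) := by
  have h1 : Module.End.IsSemisimple (f.rTensor M') :=
    isSemisimple_map_algHom (Module.End.rTensorAlgHom K M M') hf
  have h2 : Module.End.IsSemisimple (g.lTensor M) :=
    isSemisimple_map_algHom (Module.End.lTensorAlgHom K M' M) hg
  have hc : Commute (f.rTensor M') (g.lTensor M) := by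
    change _ * _ = _ * _
    rw [Module.End.mul_eq_comp, Module.End.mul_eq_comp, LinearMap.rTensor_comp_lTensor,
      LinearMap.lTensor_comp_rTensor]
  rw [← LinearMap.rTensor_comp_lTensor, ← Module.End.mul_eq_comp]
  exact Module.End.IsSemisimple.mul_of_commute hc h1 h2

/-- **Tensor products of Frobenius-semisimple Weil–Deligne representations are
Frobenius-semisimple**: `(σ ⊗ τ).ρ(w) = σ.ρ(w) ⊗ τ.ρ(w)` (`WeilDeligneRep.tprod_ρ_apply`) is a
tensor product of semisimple endomorphisms (`isSemisimple_tensorProduct_map`; characteristic-zero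
fields are perfect).  Ref: Deligne, Antwerp II (1973), §8.6; Tate, *Number theoretic background*
(Corvallis 1979), (4.1.3), (4.1.5). [cite: Corvallis1979, (4.1.5)] -/
theorem isFrobSemisimple_tprod {F : Type*} [Field F] [ValuativeRel F] [TopologicalSpace F]
    [IsNonarchimedeanLocalField F] {C : Type*} [Field C] [CharZero C]
    {V : Type*} [AddCommGroup V] [Module C V] [FiniteDimensional C V]
    {W : Type*} [AddCommGroup W] [Module C W] [FiniteDimensional C W]
    {σ : WeilDeligneRep F C V} {τ : WeilDeligneRep F C W}
    (hσ : σ.IsFrobSemisimple) (hτ : τ.IsFrobSemisimple) : (σ.tprod τ).IsFrobSemisimple :=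
  fun w => by
    rw [WeilDeligneRep.tprod_ρ_apply]
    exact isSemisimple_tensorProduct_map (hσ w) (hτ w)

/-! ## `W_F`-invariants versus `Φ`-fixed inertia invariants -/

/-- **`W_F = ⋃_k I_F Φ^k`.**  For a representation `ρ` of the Weil group and `Φ ∈ W_F` of degree
`-1` (a geometric Frobenius), a vector fixed by the inertia group `I_F` and by `Φ` is fixed by every
`w ∈ W_F`: the stabiliser of the vector is a subgroup containing `I_F` and `Φ`, and
`w = (w Φ^{deg w}) Φ^{-deg w}` with `deg (w Φ^{deg w}) = 0`, i.e. `w Φ^{deg w} ∈ I_F`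
(`deg Φ^{-k} = k`; `deg w = deg w' ⇒ w w'⁻¹ ∈ I_F`, from the discharged facts
`IsFrobPow.mul_holds`, `IsFrobPow.unique_holds`).
Ref: Tate, *Number theoretic background* (Corvallis 1979), (1.4.1), (4.1.6). [cite: Corvallis1979, (1.4.1)] -/
theorem forall_apply_eq_of_forall_mem_inertia_of_deg_eq_neg_one {F : Type*} [Field F]
    [ValuativeRel F] [TopologicalSpace F] [IsNonarchimedeanLocalField F]
    {Φ : WeilGroup F} (hΦ : deg Φ = -1)
    {C : Type*} [CommSemiring C] {X : Type*} [AddCommMonoid X] [Module C X]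
    (ρ : Representation C (WeilGroup F) X) {x : X} (hI : ∀ u ∈ inertia F, ρ u x = x)
    (hΦx : ρ Φ x = x) (w : WeilGroup F) : ρ w x = x := by
  -- the stabiliser of `x`
  let S : Subgroup (WeilGroup F) :=
    { carrier := {w | ρ w x = x}
      mul_mem' := fun {w w'} hw hw' => by
        change ρ w x = x at hw
        change ρ w' x = x at hw'
        change ρ (w * w') x = x
        rw [map_mul, Module.End.mul_apply, hw', hw]
      one_mem' := by
        change ρ 1 x = x
        rw [map_one, Module.End.one_apply]
      inv_mem' := fun {w} hw => by
        change ρ w x = x at hw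
        change ρ w⁻¹ x = x
        conv_lhs => rw [← hw]
        exact ρ.inv_self_apply w x }
  have hdeg : ∀ k : ℤ, deg (Φ ^ k) = -k := fun k => by
    have h := map_zpow (degHom F IsFrobPow.mul_holds IsFrobPow.unique_holds) Φ k
    rw [degHom_apply, degHom_apply, hΦ, ← ofAdd_zsmul] at h
    rw [Multiplicative.ofAdd.injective h, smul_eq_mul, mul_neg, mul_one]
  have h1 : w * (Φ ^ (-deg w))⁻¹ ∈ S :=
    hI _ (mul_inv_mem_inertia_of_deg_eq (by rw [hdeg, neg_neg]))
  have h2 : w ∈ S := by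
    have h := S.mul_mem h1 (S.zpow_mem (show Φ ∈ S from hΦx) (-deg w))
    rwa [inv_mul_cancel_right] at h
  exact h2

/-- **The `Φ`-fixed vectors of `(ker N)^{I_F}` are the Weil–Deligne invariants `ker N ⊓ X^{W_F}`.**
For a Weil–Deligne representation `r = (ρ, N)` and `Φ` of degree `-1`, the eigenspace for the
eigenvalue `1` of `ρ(Φ)|_{(ker N)^{I_F}}`, viewed inside `X`, is `ker N ⊓ X^{W_F}`
(`forall_apply_eq_of_forall_mem_inertia_of_deg_eq_neg_one` for `⊆`; the converse is immediate).
Ref: Tate, *Number theoretic background* (Corvallis 1979), (4.1.6). [cite: Corvallis1979, (4.1.6)] -/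
theorem map_subtype_eigenspace_restrictInertiaInvariantsKerN_one {F : Type*} [Field F]
    [ValuativeRel F] [TopologicalSpace F] [IsNonarchimedeanLocalField F]
    (hn : absInertia_normal F) {Φ : WeilGroup F} (hΦ : deg Φ = -1)
    {C : Type*} [Field C] [CharZero C] {X : Type*} [AddCommGroup X] [Module C X]
    (r : WeilDeligneRep F C X) :
    ((r.restrictInertiaInvariantsKerN hn Φ).eigenspace 1).map r.inertiaInvariantsKerN.subtype =
      LinearMap.ker r.N ⊓ r.ρ.invariants := by
  ext x
  simp only [Submodule.mem_map, Module.End.mem_eigenspace_iff, one_smul, Submodule.subtype_apply,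
    Submodule.mem_inf, LinearMap.mem_ker, Representation.mem_invariants]
  constructor
  · rintro ⟨v, hv, rfl⟩
    have hv' := (r.mem_inertiaInvariantsKerN_iff (v : X)).mp v.2
    have hΦv : r.ρ Φ v = v := congrArg Subtype.val hv
    exact ⟨hv'.1, forall_apply_eq_of_forall_mem_inertia_of_deg_eq_neg_one hΦ r.ρ hv'.2 hΦv⟩
  · rintro ⟨hN, hρ⟩
    exact ⟨⟨x, (r.mem_inertiaInvariantsKerN_iff x).mpr ⟨hN, fun u _ => hρ u⟩⟩,
      Subtype.ext (hρ Φ), rfl⟩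

/-! ## Pole order = dimension of the Weil–Deligne invariants -/

/-- **Pole order of `L(s, r)` at `s = 0` for Frobenius-semisimple `r`.**  For a
Frobenius-semisimple Weil–Deligne representation `r = (ρ, N)` on a finite-dimensional space `X`
over a field of characteristic `0`, the multiplicity of the root `T = 1` of the Euler factor
`det(1 - T·Φ | (ker N)^{I_F})` is `dim (ker N ⊓ X^{W_F})`: the Euler factor is the reverse of the
characteristic polynomial of `M = ρ(Φ)|_{(ker N)^{I_F}}` (`WeilDeligneRep.eulerFactor_eq_reverse_charpoly`;
reversal preserves the multiplicity of the root `1`), `M` is semisimple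
(`Module.End.IsSemisimple.restrict`) so the algebraic multiplicity of the eigenvalue `1`
(`LinearMap.finrank_maxGenEigenspace_eq`) is `dim ker (M - 1)`
(`Module.End.IsFinitelySemisimple.maxGenEigenspace_eq_eigenspace`), and `ker (M - 1)` is
`ker N ⊓ X^{W_F}` (`map_subtype_eigenspace_restrictInertiaInvariantsKerN_one`).
Ref: Tate, *Number theoretic background* (Corvallis 1979), (4.1.6); Henniart, Bull. SMF 130
(2002), §1.7. [cite: Corvallis1979, (4.1.6)] -/
theorem rootMultiplicity_eulerFactor_eq_finrank_of_isFrobSemisimple {F : Type*} [Field F]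
    [ValuativeRel F] [TopologicalSpace F] [IsNonarchimedeanLocalField F]
    (hn : absInertia_normal F) (hex : exists_isFrobPow (F := F))
    {C : Type*} [Field C] [CharZero C] {X : Type*} [AddCommGroup X] [Module C X]
    [FiniteDimensional C X] (r : WeilDeligneRep F C X) (hr : r.IsFrobSemisimple) :
    rootMultiplicity 1 (r.eulerFactor hn hex) =
      Module.finrank C ↥(LinearMap.ker r.N ⊓ r.ρ.invariants) := by
  obtain ⟨Φ, hΦ⟩ : ∃ Φ : WeilGroup F, deg Φ = -1 := ⟨_, WeilDeligneRep.deg_geomFrob' hex⟩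
  -- `M = ρ(Φ)|_{(ker N)^{I_F}}` is semisimple
  have hp : r.inertiaInvariantsKerN ∈ Module.End.invtSubmodule (r.ρ Φ) := by
    intro v hv
    exact r.ρ_apply_mem_inertiaInvariantsKerN hn Φ hv
  have hM : (r.restrictInertiaInvariantsKerN hn Φ).IsSemisimple := (hr Φ).restrict hp
  -- the Euler factor is the reversed characteristic polynomial of `M`
  have hrev : (r.restrictInertiaInvariantsKerN hn Φ).charpoly.reverse.rootMultiplicity 1 =
      (r.restrictInertiaInvariantsKerN hn Φ).charpoly.rootMultiplicity 1 := by
    simpa only [inv_one] using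
      Literature.NumberTheory.EllipticCurves.FunctionField.rootMultiplicity_inv_reverse
        (r.restrictInertiaInvariantsKerN hn Φ).charpoly (one_ne_zero (α := C))
  rw [r.eulerFactor_eq_reverse_charpoly hn hex hΦ, hrev, ← LinearMap.finrank_maxGenEigenspace_eq,
    hM.isFinitelySemisimple.maxGenEigenspace_eq_eigenspace,
    ← map_subtype_eigenspace_restrictInertiaInvariantsKerN_one hn hΦ r]
  exact LinearEquiv.finrank_eq (Submodule.equivSubtypeMap _ _)

/-- **Stub S-17a-A (pole order = dimension of the Weil–Deligne invariants).**  For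
Frobenius-semisimple Weil–Deligne representations `σ` on `V` and `τ` on `W` (finite-dimensional
complex), the multiplicity of the root `X = 1` of the Euler factor
`det(1 - X·Φ | (ker N_{σ⊗τ})^{I_F})` of `σ ⊗ τ` — the order of the pole of `L(s, σ ⊗ τ)` at `s = 0` —
equals `dim_ℂ (ker N_{σ⊗τ} ⊓ (V ⊗ W)^{W_F})`: `σ ⊗ τ` is Frobenius-semisimple
(`isFrobSemisimple_tprod`) and `rootMultiplicity_eulerFactor_eq_finrank_of_isFrobSemisimple`
applies.  Ref: Tate, *Number theoretic background* (Corvallis 1979), (4.1.6); Henniart,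
Bull. SMF 130 (2002), §1.7. [cite: HenniartBSMF2002, §1.7] -/
theorem stub_rootMultiplicity_eulerFactor_tprod_eq_finrank : ∀ (F : Type) [Field F] [ValuativeRel F] [TopologicalSpace F] [IsNonarchimedeanLocalField F] (hn : absInertia_normal F) (hex : @exists_isFrobPow F _ _ _ _) (V : Type) [AddCommGroup V] [Module ℂ V] [FiniteDimensional ℂ V] (W : Type) [AddCommGroup W] [Module ℂ W] [FiniteDimensional ℂ W] (σ : WeilDeligneRep F ℂ V) (τ : WeilDeligneRep F ℂ W), σ.IsFrobSemisimple → τ.IsFrobSemisimple → rootMultiplicity 1 ((σ.tprod τ).eulerFactor hn hex) = Module.finrank ℂ ↥(LinearMap.ker (σ.tprod τ).N ⊓ (σ.tprod τ).ρ.invariants) := by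
  intro F _ _ _ _ hn hex V _ _ _ W _ _ _ σ τ hσ hτ
  exact rootMultiplicity_eulerFactor_eq_finrank_of_isFrobSemisimple hn hex (σ.tprod τ)
    (isFrobSemisimple_tprod hσ hτ)

end Summit.Langlands.Langlands.Theorems.ReciprocityUpToIrreducibilityR
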